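import Summits.Schanuel.Schanuel.Theorems.RootDecomp1EMultiplierField

/-!
# RootDecomp1EMultiplierFieldMembers — part 2/4 of the port of lens-2 gen 12 «MULTIPLIER FIELD» (ROUND 12 of route-Schanuel-RootDecomp1E, THEOREM ROUND)

§2b–§3b: certified open members — the cyclotomic K-line cycLine = log 2·(1, ζ₅, ζ₅², ζ₅³) and the Gaussian biplane G = (1, i, π, πi); biplanes over quadratic fields at n = 4.

Port (census-1 gen 8) of HOME/decomp-schanuel-lens-2/g12/MultiplierField.lean (sha256 5884507d…, 910 l; critic VERDICT 2026-08-30T15:36:56Z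
ACCEPTED — PATH T, port CLEARED with hygiene h1–h4: the two unused simp arguments dropped; cell predicates are DEFINITIONS of this
decomposition (not cited facts); the tree theorems `smallTrdeg_thm_2_9_pos` / `nesterenko` stay explicit binders h29 / hN as in
RootDecomp1EEStableRung; `closes` kept, informational). Namespace `Summit.Schanuel.Schanuel.Theorems.RootDecomp1EMultiplierField` (node: …Theses.MultiplierField);
statements and proofs verbatim. `--supports stmt-Schanuel-31409` (EStableDefectOne, the CM type). Sorry-free; standard axioms.
Nothing here proves Schanuel; rung 0.
-/

set_option linter.dupNamespace false

namespace Summit.Schanuel.Schanuel.Theorems.RootDecomp1EMultiplierField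


open Complex IntermediateField Module Polynomial
open Summit.Schanuel.Schanuel.Theses.RootDecomp1E (DefectOneSchanuel EStableDefectOne PlainDefectOne
  ClosedFormAtomSchanuel AlgAnchoredDarkAtomSchanuel LineLogDarkAtomSchanuel DeepLogDarkAtomSchanuel
  OffAxisClosure FreeDarkAtomSchanuel)
open Summit.Schanuel.Schanuel.Theorems.RootDecomp1EAnchor (isAlgebraic_of_mem_adjoin trdeg_adjoin_le_of_isAlgebraic
  mem_adjoin_of_mem_span exp_isAlgebraic_of_mem_span trdeg_le_of_mem_span trdeg_eq_of_span_eq offAxisClosure_holds)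
open Summit.Schanuel.Schanuel.Theorems.RootDecomp1EEStableStructure (degree_dvd eStable_structure eStable_prime_isLine)
open Summit.Schanuel.Schanuel.Theorems.RootDecomp1EEStableRung (defectOne_of_le_two mul_mem_span_of_gens
  one_beta_linearIndependent two_le_trdeg_of_eStable_three)
open Summit.Schanuel.Schanuel.Theorems.RootDecomp1EDefectOneSplit (defectOneSchanuelGlue_holds)
open Summit.Schanuel.Schanuel.Theorems.RootDecomp1EModuleType (SubMinimalDefect)
open Summit.Schanuel.Schanuel.Theorems.RootDecomp1EModuleGrids (rat_mul_pi_eq_rat)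
open Summit.Schanuel.Schanuel.Theorems.RootDecomp1EMultiplicationTypeLeaves (defectOne_quarticLine_of_conj23
  two_le_trdeg_of_eStable sub_two_le_trdeg_of_subMinimal)
open Summit.Schanuel.Schanuel.Theorems.RootDecomp1ELevels (LWLevel le_trdeg_of_algebraicIndependent le_trdeg_of_lwLevel)
open Literature.Barriers.Schanuel (smallTrdeg_thm_2_9_pos WaldschmidtConjecture_2_3 isAlgebraic_I)
open Literature.NumberTheory.Transcendental (nesterenko transcendental_pi_holds algebraicIndependent_exp_holds)

noncomputable section

/-- (print-twin of `RoyWaldschmidt1997.isAlgebraic_ratCast`, kept private) A rational number is algebraic (`Rat.cast` normal form). -/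
private theorem isAlgebraic_ratCast (q : ℚ) : IsAlgebraic ℚ (q : ℂ) := by
  have h := isAlgebraic_algebraMap (R := ℚ) (A := ℂ) q
  rwa [eq_ratCast] at h

/-- (print-twin of `RigidCore.CalibrationR.transcendental_pi_complex`, kept private) `π ∈ ℂ` is transcendental (tree theorem `transcendental_pi_holds`, transported along `ℝ → ℂ`). -/
private theorem transcendental_pi_complex : Transcendental ℚ (Real.pi : ℂ) := fun hc =>
  transcendental_pi_holds ((isAlgebraic_algebraMap_iff (algebraMap ℝ ℂ).injective).mp hc)


/-! ### §2b CERTIFIED OPEN MEMBER of the K-line layer `4`: the cyclotomic line `log 2·(1, ζ₅, ζ₅², ζ₅³)` -/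

/-- `ζ₅ = e^{2πi/5}`. -/
def zeta5 : ℂ := cexp (2 * Real.pi * I / 5)

/-- `IsPrimitiveRoot zeta5 5`. -/
theorem zeta5_primitive : IsPrimitiveRoot zeta5 5 := by
  simpa [zeta5] using Complex.isPrimitiveRoot_exp 5 (by norm_num)

/-- `IsAlgebraic ℚ zeta5`. -/
theorem zeta5_isAlgebraic : IsAlgebraic ℚ zeta5 := by
  refine ⟨X ^ 5 - C 1, (monic_X_pow_sub_C (1 : ℚ) (by norm_num)).ne_zero, ?_⟩
  simp [zeta5_primitive.pow_eq_one]

/-- `[ℚ(ζ₅) : ℚ] = 4` (`minpoly = Φ₅`). -/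
theorem natDegree_minpoly_zeta5 : (minpoly ℚ zeta5).natDegree = 4 := by
  rw [← cyclotomic_eq_minpoly_rat zeta5_primitive (by norm_num), natDegree_cyclotomic,
    Nat.totient_prime (by norm_num : Nat.Prime 5)]

/-- `zeta5 ^ 4 = -(1 + zeta5 + zeta5 ^ 2 + zeta5 ^ 3)`. -/
theorem zeta5_pow_four : zeta5 ^ 4 = -(1 + zeta5 + zeta5 ^ 2 + zeta5 ^ 3) := by
  have h := zeta5_primitive.geom_sum_eq_zero (by norm_num : 1 < 5)
  simp only [Finset.sum_range_succ, Finset.sum_range_zero, zero_add, pow_zero, pow_one] at h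
  linear_combination h

/-- `1, ζ₅, ζ₅², ζ₅³` are ℚ-free. -/
theorem zeta5_pow_linearIndependent : LinearIndependent ℚ (fun k : Fin 4 => zeta5 ^ (k : ℕ)) := by
  have hcomp : (fun i : Fin (minpoly ℚ zeta5).natDegree => zeta5 ^ (i : ℕ)) ∘ (finCongr natDegree_minpoly_zeta5.symm) =
      fun k : Fin 4 => zeta5 ^ (k : ℕ) := by
    funext k; simp
  rw [← hcomp]
  exact (linearIndependent_pow (K := ℚ) zeta5).comp _ (finCongr natDegree_minpoly_zeta5.symm).injective

/-- **THE CYCLOTOMIC LINE** `cycLine = log 2 · (1, ζ₅, ζ₅², ζ₅³)`; its exponentials are `2, 2^{ζ₅}, 2^{ζ₅²}, 2^{ζ₅³}`. -/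
def cycLine : Fin 4 → ℂ := fun k => zeta5 ^ (k : ℕ) * (Real.log 2 : ℂ)

/-- `ℂ) ≠ 0`. -/
theorem log_two_ne_zero : ((Real.log 2 : ℝ) : ℂ) ≠ 0 :=
  Complex.ofReal_ne_zero.mpr (Real.log_pos one_lt_two).ne'

/-- `cycLine` is ℚ-free. -/
theorem cycLine_linearIndependent : LinearIndependent ℚ cycLine :=
  linearIndependent_mul_const zeta5_pow_linearIndependent log_two_ne_zero

/-- `cycLine` is a K-LINE with `K = ℚ(ζ₅)`: the multiplier `ζ₅` has full degree `4`. -/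
theorem cycLine_kline : IsKLine cycLine := by
  refine ⟨zeta5, zeta5_isAlgebraic, natDegree_minpoly_zeta5, fun i => ?_⟩
  have g : ∀ k : Fin 4, zeta5 ^ (k : ℕ) * (Real.log 2 : ℂ) ∈ Submodule.span ℚ (Set.range cycLine) :=
    fun k => Submodule.subset_span ⟨k, rfl⟩
  by_cases hi : (i : ℕ) + 1 < 4
  · -- `ζ₅ · ζ₅^k log 2 = ζ₅^{k+1} log 2` is again a coordinate
    have e : zeta5 * cycLine i = zeta5 ^ (((⟨(i : ℕ) + 1, hi⟩ : Fin 4) : ℕ)) * (Real.log 2 : ℂ) := by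
      simp only [cycLine]; ring
    rw [e]; exact g ⟨(i : ℕ) + 1, hi⟩
  · -- `k = 3`: `ζ₅⁴ log 2 = −(1 + ζ₅ + ζ₅² + ζ₅³) log 2`
    have hi3 : (i : ℕ) = 3 := by omega
    have e : zeta5 * cycLine i = -(zeta5 ^ ((0 : Fin 4) : ℕ) * (Real.log 2 : ℂ) +
        zeta5 ^ ((1 : Fin 4) : ℕ) * (Real.log 2 : ℂ) + zeta5 ^ ((2 : Fin 4) : ℕ) * (Real.log 2 : ℂ) +
        zeta5 ^ ((3 : Fin 4) : ℕ) * (Real.log 2 : ℂ)) := by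
      simp only [cycLine, hi3, Fin.val_zero, Fin.val_one, Fin.val_two]
      rw [show ((3 : Fin 4) : ℕ) = 3 from rfl, show zeta5 * (zeta5 ^ 3 * (Real.log 2 : ℂ)) =
        zeta5 ^ 4 * (Real.log 2 : ℂ) by ring, zeta5_pow_four]
      ring
    rw [e]
    exact Submodule.neg_mem _ (Submodule.add_mem _ (Submodule.add_mem _ (Submodule.add_mem _ (g 0) (g 1)) (g 2))
      (g 3))

/-- **KNOWN FLOOR at the member: `trdeg ℚ(cycLine, e^{cycLine}) ≥ 2`** (Theorem 2.9, tree-proved). -/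
theorem two_le_trdeg_cycLine (h29 : smallTrdeg_thm_2_9_pos) :
    (2 : Cardinal) ≤ Algebra.trdeg ℚ ↥(adjoin ℚ (Set.range cycLine ∪ Set.range (cexp ∘ cycLine))) :=
  two_le_trdeg_of_kline h29 (by norm_num) cycLine_linearIndependent cycLine_kline

/-- **THE MEMBER'S CONCLUSION** (of `GelfondLineDefectOne` / of `S⁻` at `cycLine`) is `3 ≤ trdeg ℚ(ζ₅^k log 2, 2^{ζ₅^k})`
— the `t₂`-clause of Conjecture 2.3 on the `(4,4)` grid of `(log 2, ζ₅)`; printed reach `2`; OPEN. -/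
theorem cycLine_conclusion_iff :
    ((4 : ℕ) : Cardinal) ≤ Algebra.trdeg ℚ ↥(adjoin ℚ (Set.range cycLine ∪ Set.range (cexp ∘ cycLine))) + 1 ↔
      (3 : Cardinal) ≤ Algebra.trdeg ℚ ↥(adjoin ℚ (Set.range cycLine ∪ Set.range (cexp ∘ cycLine))) :=
  four_le_add_one_iff _

/-- … and it is DECIDED modulo Conjecture 2.3. -/
theorem cycLine_decided_of_conj23 (h23 : WaldschmidtConjecture_2_3) :
    (3 : Cardinal) ≤ Algebra.trdeg ℚ ↥(adjoin ℚ (Set.range cycLine ∪ Set.range (cexp ∘ cycLine))) :=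
  (cycLine_conclusion_iff).mp (kline_four_of_conj23 h23 cycLine cycLine_linearIndependent cycLine_kline)

/-- `GelfondLineDefectOne` (hence `S⁻`, hence Schanuel) decides the member. -/
theorem cycLine_of_gelfondLine (h : GelfondLineDefectOne) :
    (3 : Cardinal) ≤ Algebra.trdeg ℚ ↥(adjoin ℚ (Set.range cycLine ∪ Set.range (cexp ∘ cycLine))) :=
  (cycLine_conclusion_iff).mp (h 4 cycLine cycLine_linearIndependent cycLine_kline)

/-! ## §3 K-MODULES at the first composite length: BIPLANES over quadratic fields (`n = 4`) -/

/-- `KModuleDefectOne` at `n = 4`: `S⁻` at the first failure on the rank-2 modules over quadratic fields. -/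
def BiplaneDefectOneFour : Prop :=
  ∀ z : Fin 4 → ℂ, LinearIndependent ℚ z → IsKModule z → SubMinimalDefect 4 z →
    ((4 : ℕ) : Cardinal) ≤ Algebra.trdeg ℚ ↥(adjoin ℚ (Set.range z ∪ Set.range (cexp ∘ z))) + 1

/-- MEMBER-CERTIFIABLE FORM: the (uncertifiable) first-failure hypothesis replaced by its only kernel consequence at
`n = 4`, `trdeg F_z ≥ 2` (tree `sub_two_le_trdeg_of_subMinimal`). -/
def BiplaneDefectOneFour' : Prop :=
  ∀ z : Fin 4 → ℂ, LinearIndependent ℚ z → IsKModule z →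
    (2 : Cardinal) ≤ Algebra.trdeg ℚ ↥(adjoin ℚ (Set.range z ∪ Set.range (cexp ∘ z))) →
    ((4 : ℕ) : Cardinal) ≤ Algebra.trdeg ℚ ↥(adjoin ℚ (Set.range z ∪ Set.range (cexp ∘ z))) + 1

/-- `BiplaneDefectOneFour`. -/
theorem biplane_of_kModuleDefectOne (h : KModuleDefectOne) : BiplaneDefectOneFour :=
  fun z hz hK hsub => h 4 z hz hK hsub

/-- `BiplaneDefectOneFour`. -/
theorem biplane_of_biplane' (h : BiplaneDefectOneFour') : BiplaneDefectOneFour := by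
  intro z hz hK hsub
  refine h z hz hK ?_
  have h2 := sub_two_le_trdeg_of_subMinimal z hz hsub
  norm_num at h2
  exact h2

/-- `BiplaneDefectOneFour'`. -/
theorem biplane'_of_defectOne (hD : DefectOneSchanuel) : BiplaneDefectOneFour' := fun z hz _ _ => hD 4 z hz

/-- In a K-module of length `4` every irrational multiplier is QUADRATIC (`d ∣ 4`, `2 ≤ d < 4`). -/
theorem quadratic_of_kmodule_four {z : Fin 4 → ℂ} (hz : LinearIndependent ℚ z) (hK : IsKModule z) {β : ℂ}
    (hβ : IsAlgebraic ℚ β) (hβq : β ∉ Set.range (algebraMap ℚ ℂ))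
    (hβV : ∀ i, β * z i ∈ Submodule.span ℚ (Set.range z)) : (minpoly ℚ β).natDegree = 2 := by
  have hd := degree_dvd z hz hβ hβV
  have hlt := hK.2 β hβ hβV
  have h2 := two_le_of_not_mem_range hβ hβq
  generalize (minpoly ℚ β).natDegree = d at hd hlt h2 ⊢
  interval_cases d
  · rfl
  · exact absurd hd (by norm_num)

/-- **BIPLANE COORDINATES**: a K-module quadruple spans `ℚ(β)u ⊕ ℚ(β)v = span(u, βu, v, βv)` with `β` QUADRATIC
(tree `eStable_structure` with `d = 2`, `m = 2`).  `S⁻` there reads `trdeg ℚ(β, u, v, e^u, e^{βu}, e^v, e^{βv}) ≥ 3`. -/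
theorem biplane_coordinates {z : Fin 4 → ℂ} (hz : LinearIndependent ℚ z) (hK : IsKModule z) :
    ∃ (β : ℂ) (u : Fin 2 → ℂ), IsAlgebraic ℚ β ∧ (minpoly ℚ β).natDegree = 2 ∧
      (∀ i, β * z i ∈ Submodule.span ℚ (Set.range z)) ∧ (∀ j, u j ∈ Submodule.span ℚ (Set.range z)) ∧
      LinearIndependent ℚ (fun p : Fin 2 × Fin 2 => β ^ (p.1 : ℕ) * u p.2) ∧
      Submodule.span ℚ (Set.range fun p : Fin 2 × Fin 2 => β ^ (p.1 : ℕ) * u p.2) =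
        Submodule.span ℚ (Set.range z) := by
  obtain ⟨β, hβ, hβq, hβV⟩ := hK.1
  have hd : (minpoly ℚ β).natDegree = 2 := quadratic_of_kmodule_four hz hK hβ hβq hβV
  obtain ⟨m, u, hmn, hu, hli, hspan⟩ := eStable_structure z hz hβ hβV
  rw [hd] at hmn
  have hm : m = 2 := by omega
  subst hm
  let e : Fin 2 × Fin 2 ≃ Fin (minpoly ℚ β).natDegree × Fin 2 := (finCongr hd.symm).prodCongr (Equiv.refl _)
  have hcomp : (fun p : Fin (minpoly ℚ β).natDegree × Fin 2 => β ^ (p.1 : ℕ) * u p.2) ∘ e =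
      fun p : Fin 2 × Fin 2 => β ^ (p.1 : ℕ) * u p.2 := by
    funext p; simp [e]
  refine ⟨β, u, hβ, hd, hβV, hu, ?_, ?_⟩
  · rw [← hcomp]; exact hli.comp e e.injective
  · rw [← hspan, ← hcomp, e.surjective.range_comp]

/-! ### §3b CERTIFIED OPEN MEMBER of the biplane cell: the Gaussian biplane `G = (1, i, π, πi)` -/

/-- **THE GAUSSIAN BIPLANE** `G = (1, i, π, πi)`: `span_ℚ G = ℚ(i) ⊕ ℚ(i)π`. -/
def G : Fin 4 → ℂ := ![1, I, (Real.pi : ℂ), (Real.pi : ℂ) * I]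

/-- `G 0 = 1`. -/
@[simp] theorem G_zero : G 0 = 1 := rfl
/-- `G 1 = I`. -/
@[simp] theorem G_one : G 1 = I := rfl
/-- `G 2 = (Real.pi : ℂ)`. -/
@[simp] theorem G_two : G 2 = (Real.pi : ℂ) := rfl
/-- `G 3 = (Real.pi : ℂ) * I`. -/
@[simp] theorem G_three : G 3 = (Real.pi : ℂ) * I := rfl

/-- `G` is ℚ-free (real and imaginary parts; `π ∉ ℚ`). -/
theorem G_linearIndependent : LinearIndependent ℚ G := by
  rw [Fintype.linearIndependent_iff]
  intro g hg
  simp only [Fin.sum_univ_four, G_zero, G_one, G_two, G_three, Rat.smul_def] at hg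
  have hre := congrArg Complex.re hg
  have him := congrArg Complex.im hg
  simp only [Complex.add_re, Complex.add_im, Complex.mul_re, Complex.mul_im, Complex.ofReal_re,
    Complex.ofReal_im, Complex.I_re, Complex.I_im, Complex.ratCast_re, Complex.ratCast_im,
    Complex.zero_re, Complex.zero_im, mul_zero, zero_mul, add_zero, zero_add,
    mul_one, sub_self, sub_zero] at hre him
  obtain ⟨h2, h0⟩ := rat_mul_pi_eq_rat (t := g 2) (r := -g 0) (by push_cast; linear_combination hre)
  obtain ⟨h3, h1⟩ := rat_mul_pi_eq_rat (t := g 3) (r := -g 1) (by push_cast; linear_combination him)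
  intro i
  fin_cases i
  · simpa using h0
  · simpa using h1
  · exact h2
  · exact h3

/-- `i` is a multiplier of `span_ℚ G`. -/
theorem I_mul_G_mem : ∀ i, I * G i ∈ Submodule.span ℚ (Set.range G) := by
  have g : ∀ k : Fin 4, G k ∈ Submodule.span ℚ (Set.range G) := fun k => Submodule.subset_span ⟨k, rfl⟩
  intro i
  fin_cases i
  · simpa using g 1
  · have e : I * G 1 = -G 0 := by simp
    rw [show (⟨1, by norm_num⟩ : Fin 4) = 1 from rfl, e]; exact Submodule.neg_mem _ (g 0)
  · have e : I * G 2 = G 3 := by simp [mul_comm]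
    rw [show (⟨2, by norm_num⟩ : Fin 4) = 2 from rfl, e]; exact g 3
  · have e : I * G 3 = -G 2 := by
      simp only [G_three, G_two]
      rw [show I * ((Real.pi : ℂ) * I) = (Real.pi : ℂ) * I ^ 2 by ring, Complex.I_sq]; ring
    rw [show (⟨3, by norm_num⟩ : Fin 4) = 3 from rfl, e]; exact Submodule.neg_mem _ (g 2)

/-- `span_ℚ G` is E-STABLE (multiplier `i`). -/
theorem G_eStable : EStable G := ⟨I, isAlgebraic_I, I_not_mem_range, I_mul_G_mem⟩

/-- **THE MULTIPLIER ALGEBRA OF `span_ℚ G` IS EXACTLY `ℚ(i)`**: a multiplier is `a + bi` with `a, b ∈ ℚ`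
(a multiplier with a `π`-component would make `π` algebraic). -/
theorem G_multiplier_mem_gaussian {β : ℂ} (hβ : IsAlgebraic ℚ β)
    (hβV : ∀ i, β * G i ∈ Submodule.span ℚ (Set.range G)) : ∃ a b : ℚ, β = a + b * I := by
  have hmem : β ∈ Submodule.span ℚ (Set.range G) := by simpa using hβV 0
  obtain ⟨c, hc⟩ := (Submodule.mem_span_range_iff_exists_fun ℚ).mp hmem
  simp only [Fin.sum_univ_four, G_zero, G_one, G_two, G_three, Rat.smul_def] at hc
  -- `β = c₀ + c₁ i + (c₂ + c₃ i) π`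
  by_cases hw : (c 2 : ℂ) + c 3 * I = 0
  · have h2 : c 2 = 0 := by have := congrArg Complex.re hw; simpa using this
    have h3 : c 3 = 0 := by have := congrArg Complex.im hw; simpa using this
    refine ⟨c 0, c 1, ?_⟩
    rw [← hc, h2, h3]; push_cast; ring
  · exfalso
    apply transcendental_pi_complex
    have hπ : (Real.pi : ℂ) = (β - ((c 0 : ℂ) + c 1 * I)) * ((c 2 : ℂ) + c 3 * I)⁻¹ := by
      rw [eq_mul_inv_iff_mul_eq₀ hw, ← hc]; ring
    rw [hπ]
    exact (hβ.sub ((isAlgebraic_ratCast _).add ((isAlgebraic_ratCast _).mul isAlgebraic_I))).mul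
      ((isAlgebraic_ratCast _).add ((isAlgebraic_ratCast _).mul isAlgebraic_I)).inv

/-- Hence every multiplier of `span_ℚ G` has degree `≤ 2` … -/
theorem G_multiplier_natDegree_le_two {β : ℂ} (hβ : IsAlgebraic ℚ β)
    (hβV : ∀ i, β * G i ∈ Submodule.span ℚ (Set.range G)) : (minpoly ℚ β).natDegree ≤ 2 := by
  obtain ⟨a, b, rfl⟩ := G_multiplier_mem_gaussian hβ hβV
  -- `a + bi` is a root of `X² − 2aX + (a² + b²)`
  set p : ℚ[X] := X ^ 2 + (C (-2 * a) * X + C (a ^ 2 + b ^ 2)) with hp_def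
  have hq : (C (-2 * a) * X + C (a ^ 2 + b ^ 2)).degree < ((2 : ℕ) : WithBot ℕ) :=
    lt_of_le_of_lt degree_linear_le (by exact_mod_cast (by norm_num : (1 : ℕ) < 2))
  have hp : p.Monic := monic_X_pow_add hq
  have hroot : aeval ((a : ℂ) + b * I) p = 0 := by
    simp only [hp_def, map_add, map_mul, map_pow, aeval_X, aeval_C, eq_ratCast]
    push_cast
    have hI : I ^ 2 = -1 := Complex.I_sq
    linear_combination ((b : ℂ) ^ 2) * hI
  have hdeg := minpoly.degree_le_of_ne_zero ℚ ((a : ℂ) + b * I) hp.ne_zero hroot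
  have hp2 : p.natDegree ≤ 2 :=
    natDegree_le_iff_degree_le.mpr ((degree_add_le _ _).trans (max_le (degree_X_pow_le 2) hq.le))
  exact (natDegree_le_natDegree hdeg).trans hp2

/-- … and **`G` IS A K-MODULE** (rank `2` over `ℚ(i)`): E-stable with no multiplier of degree `4`. -/
theorem G_kmodule : IsKModule G :=
  ⟨G_eStable, fun β hβ hβV => lt_of_le_of_lt (G_multiplier_natDegree_le_two hβ hβV) (by norm_num)⟩

/-- `¬ IsKLine G`. -/
theorem G_not_kline : ¬ IsKLine G := fun h => not_kmodule_of_kline h G_kmodule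

/-- The two certified members sit in opposite halves of the CM type. -/
theorem cycLine_not_kmodule : ¬ IsKModule cycLine := not_kmodule_of_kline cycLine_kline

/-- **KNOWN FLOOR at `G`: `trdeg ℚ(G, e^G) ≥ 2`** — Lindemann–Weierstrass at `(1, i)` (tree theorem, hypothesis-free):
`G` sits on storey `2` of the level tower (`LWLevel 2 G`). -/
theorem G_lwLevel_two : LWLevel 2 G := by
  refine ⟨![1, I], one_beta_linearIndependent I_not_mem_range, fun j => ?_, fun j => ?_⟩
  · fin_cases j
    · simpa using isAlgebraic_one
    · simpa using isAlgebraic_I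
  · fin_cases j
    · exact isAlgebraic_of_mem_adjoin (subset_adjoin ℚ _ (Or.inr ⟨0, rfl⟩))
    · exact isAlgebraic_of_mem_adjoin (subset_adjoin ℚ _ (Or.inr ⟨1, rfl⟩))

/-- `(2 : Cardinal) ≤ Algebra.trdeg ℚ ↥(adjoin ℚ (Set.range G ∪ Set.range (cexp ∘ G)))`. -/
theorem two_le_trdeg_G : (2 : Cardinal) ≤ Algebra.trdeg ℚ ↥(adjoin ℚ (Set.range G ∪ Set.range (cexp ∘ G))) := by
  simpa using le_trdeg_of_lwLevel G G_lwLevel_two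

/-- `ℚ(G, e^G)` and `ℚ(π, e^π, e, eⁱ)` have the same transcendence degree (`e^{πi} = −1`, `1, i` algebraic). -/
theorem trdeg_G_eq : Algebra.trdeg ℚ ↥(adjoin ℚ (Set.range G ∪ Set.range (cexp ∘ G))) =
    Algebra.trdeg ℚ ↥(adjoin ℚ ({(Real.pi : ℂ), cexp (Real.pi : ℂ), cexp 1, cexp I} : Set ℂ)) := by
  apply le_antisymm
  · refine trdeg_adjoin_le_of_isAlgebraic ?_
    have hπ : (Real.pi : ℂ) ∈ adjoin ℚ ({(Real.pi : ℂ), cexp (Real.pi : ℂ), cexp 1, cexp I} : Set ℂ) :=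
      subset_adjoin ℚ _ (by simp)
    rintro x (⟨i, rfl⟩ | ⟨i, rfl⟩)
    · fin_cases i
      · simpa using isAlgebraic_one
      · simpa using (isAlgebraic_I).tower_top
          (L := ↥(adjoin ℚ ({(Real.pi : ℂ), cexp (Real.pi : ℂ), cexp 1, cexp I} : Set ℂ)))
      · simpa using isAlgebraic_of_mem_adjoin hπ
      · simpa using (isAlgebraic_of_mem_adjoin hπ).mul ((isAlgebraic_I).tower_top
          (L := ↥(adjoin ℚ ({(Real.pi : ℂ), cexp (Real.pi : ℂ), cexp 1, cexp I} : Set ℂ))))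
    · fin_cases i
      · exact isAlgebraic_of_mem_adjoin (subset_adjoin ℚ _ (by simp))
      · exact isAlgebraic_of_mem_adjoin (subset_adjoin ℚ _ (by simp))
      · exact isAlgebraic_of_mem_adjoin (subset_adjoin ℚ _ (by simp))
      · have e : (cexp ∘ G) ⟨3, by norm_num⟩ = -1 := by simp [Complex.exp_pi_mul_I]
        rw [e]; exact isAlgebraic_one.neg
  · refine trdeg_adjoin_le_of_isAlgebraic ?_
    intro x hx
    simp only [Set.mem_insert_iff, Set.mem_singleton_iff] at hx
    rcases hx with rfl | rfl | rfl | rfl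
    · exact isAlgebraic_of_mem_adjoin (subset_adjoin ℚ _ (Or.inl ⟨2, rfl⟩))
    · exact isAlgebraic_of_mem_adjoin (subset_adjoin ℚ _ (Or.inr ⟨2, rfl⟩))
    · exact isAlgebraic_of_mem_adjoin (subset_adjoin ℚ _ (Or.inr ⟨0, rfl⟩))
    · exact isAlgebraic_of_mem_adjoin (subset_adjoin ℚ _ (Or.inr ⟨1, rfl⟩))

/-- **THE MEMBER'S CONCLUSION**: `S⁻` (or `BiplaneDefectOneFour'`, or `KModuleDefectOne` given first-failure
locality) at `G` says EXACTLY `3 ≤ trdeg ℚ(π, e^π, e, eⁱ)` — «`e` and `eⁱ` are not both algebraic over `ℚ(π, e^π)`»,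
one number beyond Nesterenko's theorem; OPEN. -/
theorem G_conclusion_iff :
    ((4 : ℕ) : Cardinal) ≤ Algebra.trdeg ℚ ↥(adjoin ℚ (Set.range G ∪ Set.range (cexp ∘ G))) + 1 ↔
      (3 : Cardinal) ≤ Algebra.trdeg ℚ ↥(adjoin ℚ ({(Real.pi : ℂ), cexp (Real.pi : ℂ), cexp 1, cexp I} : Set ℂ)) := by
  rw [four_le_add_one_iff, trdeg_G_eq]

/-- `G` is a certified member of `BiplaneDefectOneFour'`'s hypothesis class, and the cell decides it. -/
theorem G_of_biplane' (h : BiplaneDefectOneFour') :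
    (3 : Cardinal) ≤ Algebra.trdeg ℚ ↥(adjoin ℚ ({(Real.pi : ℂ), cexp (Real.pi : ℂ), cexp 1, cexp I} : Set ℂ)) :=
  G_conclusion_iff.mp (h G G_linearIndependent G_kmodule two_le_trdeg_G)

/-- `DefectOneSchanuel` (S⁻, stmt-25020) at the Gaussian biplane `G` says exactly `3 ≤ trdeg ℚ(π, e^π, e, eⁱ)`. -/
theorem G_of_defectOne (hD : DefectOneSchanuel) :
    (3 : Cardinal) ≤ Algebra.trdeg ℚ ↥(adjoin ℚ ({(Real.pi : ℂ), cexp (Real.pi : ℂ), cexp 1, cexp I} : Set ℂ)) :=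
  G_of_biplane' (biplane'_of_defectOne hD)


end

end Summit.Schanuel.Schanuel.Theorems.RootDecomp1EMultiplierField
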